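import Literature.NumberTheory.EllipticCurves.Sprung2017.SharpFlatPAdicLFunction
import Literature.NumberTheory.EllipticCurves.PlusMinusPAdicLFunctionProofs
import HarnessLib

/-!
# Sprung's ♯/♭ `p`-adic `L`-functions are not both zero (Sprung 2012, Prop. 6.14) — proof

Topic `Literature/NumberTheory/EllipticCurves`, cluster `Sprung2017` (namespace = path). A `Proofs`
companion (THEOREMS ONLY; no definition, no named fact, nothing about any particular curve asserted)
of `Sprung2017/SharpFlatPAdicLFunction.lean`, whose predicate `IsSprungPair f p a_p L♯ L♭` — the
Mazur–Tate characterisation `θ_n ≡ −(u_n L♯ + v_n L♭) (mod ω_n)` (all `n ≥ 0`) of Sprung's pair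
`(L_p^♯(E,T), L_p^♭(E,T)) ∈ Λ²` (Sprung, Algebra Number Theory 11 (2017) Thm. 1.12 / Cor. 4.4–4.5;
Sprung, J. Number Theory 132 (2012) §6 for elliptic curves) — explicitly did NOT carry the
non-vanishing of `L♯`, `L♭` (its docstring: "Non-vanishing of `L♯`, `L♭` is NOT part of the statement").
HONEST FRAMING (BSD rank-`≤ 1` residual cell `b2b-bsdres`, supersingular family, prover B = unit
`b2b-bsdres-additive-p3`, gen 16): this file PROVES the printed non-vanishing statement that IS a
theorem — the first sentence of

  S. Sprung, *Iwasawa theory for elliptic curves at supersingular primes: A pair of main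
  conjectures*, J. Number Theory 132 (2012) 1483–1506, **Proposition 6.14** (p. 1498)
  [corpus: paper:doi-10-1016-j-jnt-2011-11-003 p0016 L137–L151]: "Let `η : Δ → ℤ_p^×` be any
  character. Then at least one of `L_p^♯(E, η, X)` and `L_p^♭(E, η, X)` is a nonzero function. If
  `L(E, η, 1) ≠ 0`, then they are both nonzero. *Proof.* By a theorem of Rohrlich [Ro],
  `L_p(E, α, η, ζ_{pⁿ} − 1) ≠ 0` for `n ≫ 0`. Thus, the vector `(L_p^♯(E, η, X), L_p^♭(E, η, X))`
  can't be zero. Further, if `L(E, η, 1) ≠ 0`, then the assertion follows from the table above."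

— for the trivial tame character `η = 1` (the only one the tree's `IsSprungPair` transcribes), in the
tree's Mazur–Tate vocabulary: **for ANY pair `(L♯, L♭)` with `IsSprungPair f p a L♯ L♭`, `f` the
newform of an elliptic curve `E/ℚ` with good reduction at `p`, `L♯ ≠ 0 ∨ L♭ ≠ 0`**
(`IsSprungPair.ne_zero_or_ne_zero`). The argument is Sprung's, run WITHOUT the analytic
`L_p(E, α, T)` (which the tree does not have at a supersingular prime), exactly as the tree already
runs Pollack's Cor. 5.11 (`ne_zero_of_isCongrModOmega_even/odd` in
`PlusMinusPAdicLFunctionProofs.lean`): if `L♯ = L♭ = 0` the congruences say `θ_n ≡ 0 (mod ω_n)` in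
`Λ ⊗ ℚ_p` for EVERY `n`; evaluating at `χ(γ) − 1` (`IsCongrModOmega.eval₂_eq`,
`eval₂_mazurTateElement_eq_ratTwistedSymbolSum`) kills every Birch sum
`∑_a χ(a)[a/p^{n+e₀}]⁺_f = τ(χ)·L(E, χ̄, 1)/Ω⁺_f` at every wild character `χ` of `p`-power
conductor, i.e. `L(E, χ̄, 1) = 0` for infinitely many primitive `χ` of `p`-power conductor —
contradicting Rohrlich's theorem (Invent. Math. 75 (1984), Theorem p. 409), which is a THEOREM of
the tree (`Rohrlich1984_nonvanishing_twists_holds`). No hypothesis on `a_p`, on the reduction TYPE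
at `p` (beyond good reduction, for `p ∤ N`) or on the parity of `p` is needed for this sentence.
The second sentence ("if `L(E,1) ≠ 0` both are nonzero") is the constant-term table (P•), a tree
theorem on the Summits side (`Summit.….Supersingular.constantCoeff_chromaticL_of_isSprungPair`,
file `Supersingular/SprungConstantTerm.lean`); its assembly with this file is the Summits companion
`Supersingular/SharpFlatNonvanishing.lean` (same gen). Conjecture 6.15 of the source / Conj. 4.12 of
Sprung 2017 ("both nonzero" unconditionally) is NOT claimed.

Chromatic forms: `∃ • ∈ {♯, ♭}, L^• ≠ 0` (`IsSprungPair.exists_chromaticL_ne_zero`); "if one colour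
vanishes the other does not" (`IsSprungPair.flat_ne_zero_of_sharp_eq_zero`, `…sharp_ne_zero_of_flat_eq_zero`).
For the named fact `thm112_exists_isSprungPair` (existence of the pair, Sprung 2017 Thm. 1.12; PROVED
in the tree by harvest seat 2, `…SharpFlatPAdicLFunctionProofs`): every pair it yields has a non-zero
member (`exists_isSprungPair_ne_zero_or_ne_zero_of_thm112`).

References: [Sprung2012] Prop. 6.14 (p. 1498); [Sprung2017] Thm. 1.12, Cor. 4.4–4.5;
[RohrlichInventiones1984] Theorem (p. 409); [Pollack2003] Cor. 5.11, Prop. 6.9 (proof), Prop. 6.18.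
Design: theorems only, `namespace Literature.NumberTheory.EllipticCurves.Sprung2017`; two private
helpers adapted from the (private) §9 of `PlusMinusPAdicLFunctionProofs.lean`; default heartbeats;
axioms of every theorem `propext`, `Classical.choice`, `Quot.sound`.
-/

noncomputable section

open scoped MatrixGroups ModularForm

open CongruenceSubgroup Polynomial Literature.NumberTheory.EllipticCurves
  Literature.NumberTheory.EllipticCurves.ModularForms

namespace Literature.NumberTheory.EllipticCurves.Sprung2017

section NonVanishing

variable {W : WeierstrassCurve ℚ} [W.IsElliptic] [W.IsGloballyMinimal] {N : ℕ} [NeZero N]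
  {f : CuspForm (Gamma0 N) 2} {p : ℕ} [Fact p.Prime]

omit [NeZero N] in
/-- If `θ_n ≡ ω · 0 (mod ω_n)` in `Λ ⊗ ℚ_p`, every Birch sum `∑_a χ(a)[a/p^{n+e₀}]⁺_f` at an even
character `χ` of `p`-power order modulo `p^{n+e₀}` vanishes: evaluate the congruence at `χ(γ) − 1`
(`IsCongrModOmega.eval₂_eq`, `eval₂_mazurTateElement_eq_ratTwistedSymbolSum`). (Adapted from the
private lemma of the same name in `PlusMinusPAdicLFunctionProofs.lean`, §9.)
[cite: Pollack2003, Prop. 6.9 (proof)] [cite: Sprung2012, Prop. 6.14 (proof)] -/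
private theorem ratTwistedSymbolSum_eq_zero_of_isCongrModOmega_zero {n : ℕ} {ω : ℤ[X]}
    (h : IsCongrModOmega p n (mazurTateElement f p n) ω 0)
    (χ : DirichletCharacter ℂ_[p] (p ^ (n + cyclotomicExponent p))) (hev : χ.Even)
    (hord : ∃ j : ℕ, orderOf χ = p ^ j) : ratTwistedSymbolSum f χ = 0 := by
  set ζ : ℂ_[p] := χ (cyclotomicGenerator p : ZMod (p ^ (n + cyclotomicExponent p))) with hζ
  have hpow : ζ ^ p ^ n = 1 := by
    rw [hζ, ← map_pow, ← orderOf_cyclotomicGenerator p n, pow_orderOf_eq_one, map_one]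
  have hz : ‖ζ - 1‖ < 1 := norm_sub_one_lt_one_of_pow_prime_pow_eq_one hpow
  have hzn : (1 + (ζ - 1)) ^ p ^ n = 1 := by rwa [add_sub_cancel]
  have h1 := h.eval₂_eq hz hzn
  rw [eval₂_mazurTateElement_eq_ratTwistedSymbolSum f χ hev hord] at h1
  rw [h1]
  simp

/-- **Rohrlich's theorem forbids the vanishing of all Birch sums at all levels `p^{i+3}`**: if
every primitive even `p`-power-order character `χ` of conductor `p^{i+3}` (`i ≥ 0`) has
`∑_b χ(b)[b/p^{i+3}]⁺_f = 0`, then by Birch's formula (`ratTwistedSymbolSum_mul_plusPeriod`)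
`L(E, χ̄, 1) = 0` for infinitely many primitive `χ` of `p`-power conductor, against
`Rohrlich1984_nonvanishing_twists_holds` (Rohrlich 1984, Theorem p. 409; the argument of
`padicLFunction_ne_zero_of_rohrlich`). (Adapted from the private
`false_of_forall_ratTwistedSymbolSum_eq_zero` of `PlusMinusPAdicLFunctionProofs.lean`, §9, with the
parity bookkeeping dropped.) [cite: RohrlichInventiones1984, Theorem (p. 409)] [cite: Sprung2012, Prop. 6.14 (proof)] -/
private theorem false_of_forall_ratTwistedSymbolSum_eq_zero (hf : IsNewformOf W f)
    (hgood : W.HasGoodReductionAtPrime p)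
    (hvan : ∀ (i : ℕ) (χ : DirichletCharacter ℂ_[p] (p ^ (i + 3))), χ.IsPrimitive →
      χ.Even → (∃ j : ℕ, orderOf χ = p ^ j) → ratTwistedSymbolSum f χ = 0) : False := by
  classical
  have hp : p.Prime := Fact.out
  have hQ : coeffField f = ⊥ := hf.coeffField_eq_bot
  have hpN : ¬ p ∣ N := not_dvd_level_of_isNewformOf hf hgood
  have hR := Rohrlich1984_nonvanishing_twists_holds.primePow hf.1 hpN
  have hB : ratTwistedSymbolSum_mul_plusPeriod (f := f) :=
    ratTwistedSymbolSum_mul_plusPeriod_of_lattice isZLattice_periodLattice_holds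
      (exists_nsmul_modularSymbol_mem_periodLattice_of_isNewformOf hf)
  -- characters over `ℚ̄`, embedded into `ℂ` and `ℂ_p`
  let K := AlgebraicClosure ℚ
  let σ : K →+* ℂ := (@IsAlgClosed.lift ℂ _ _ ℚ _ _ K _ _ (AlgebraicClosure.instAlgebra ℚ) _ _ _
    (AlgebraicClosure.isAlgebraic ℚ)).toRingHom
  let τ : K →+* ℂ_[p] := (@IsAlgClosed.lift ℂ_[p] _ _ ℚ _ _ K _ _
    (AlgebraicClosure.instAlgebra ℚ) _ _ _ (AlgebraicClosure.isAlgebraic ℚ)).toRingHom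
  have hψ : ∀ i : ℕ, ∃ ψ : DirichletCharacter K (p ^ (i + 3)),
      ψ.IsPrimitive ∧ ψ.Even ∧ ∃ j : ℕ, orderOf ψ = p ^ j := fun i ↦ by
    haveI : NeZero ((Nat.totient (p ^ (i + 3)) : ℕ) : ℚ) :=
      ⟨Nat.cast_ne_zero.mpr (Nat.totient_pos.mpr (pow_pos hp.pos _)).ne'⟩
    exact exists_isPrimitive_even_orderOf_eq_prime_pow K i
  choose ψ hψprim hψeven hψord using hψ
  -- over `ℂ`, `L(f, (σψ_i)⁻¹, 1) = 0` for every `i`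
  have hbad : ∀ i : ℕ, (⟨p ^ (i + 3), ((ψ i).ringHomComp σ)⁻¹⟩ :
      Σ m : ℕ, DirichletCharacter ℂ m) ∈
      {χ : Σ m : ℕ, DirichletCharacter ℂ m |
        χ.1 ≠ 0 ∧ χ.1.primeFactors ⊆ {p} ∧ χ.2.IsPrimitive ∧
          ∃ L : ℂ → ℂ, Differentiable ℂ L ∧
            (∀ s : ℂ, 2 < s.re → L s = twistedLSeries f χ.2 s) ∧ L 1 = 0} := by
    intro i
    haveI : NeZero (p ^ (i + 3)) := ⟨pow_ne_zero _ hp.ne_zero⟩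
    have hprimC : DirichletCharacter.IsPrimitive ((ψ i).ringHomComp σ) :=
      (isPrimitive_ringHomComp_iff σ (ψ i)).mpr (hψprim i)
    refine ⟨pow_ne_zero _ hp.ne_zero, (Nat.primeFactors_prime_pow (by omega) hp).le, ?_, ?_⟩
    · rw [DirichletCharacter.isPrimitive_def, DirichletCharacter.conductor_inv]
      exact hprimC
    obtain ⟨L, hLd, hL⟩ := exists_differentiable_eq_twistedLSeries_holds f ((ψ i).ringHomComp σ)⁻¹
    refine ⟨L, hLd, hL, ?_⟩
    have hBirch := hB hf.1 hQ hprimC ((even_ringHomComp_iff σ (ψ i)).mpr (hψeven i)) hLd hL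
    have hzero : ratTwistedSymbolSum f ((ψ i).ringHomComp σ) = 0 := by
      have hτ : ratTwistedSymbolSum f ((ψ i).ringHomComp τ) = 0 :=
        hvan i _ ((isPrimitive_ringHomComp_iff τ (ψ i)).mpr (hψprim i))
          ((even_ringHomComp_iff τ (ψ i)).mpr (hψeven i))
          (by rw [orderOf_ringHomComp]; exact hψord i)
      rw [ratTwistedSymbolSum_ringHomComp, map_eq_zero] at hτ
      rw [ratTwistedSymbolSum_ringHomComp, hτ, map_zero]
    rw [hzero, zero_mul, eq_comm, mul_eq_zero] at hBirch
    exact hBirch.resolve_left (gaussSum_stdAddChar_ne_zero hprimC)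
  -- infinitely many distinct characters, contradicting Rohrlich
  let F : ℕ → Σ m : ℕ, DirichletCharacter ℂ m := fun i ↦
    ⟨p ^ (i + 3), ((ψ i).ringHomComp σ)⁻¹⟩
  have hFinj : Function.Injective F := fun i l h ↦ by
    have h1 : p ^ (i + 3) = p ^ (l + 3) := congr_arg Sigma.fst h
    have := Nat.pow_right_injective hp.two_le h1
    omega
  have hfin : (Set.univ : Set ℕ).Finite := by
    refine (hR.preimage hFinj.injOn).subset fun i _ ↦ ?_
    exact hbad i
  exact Set.infinite_univ hfin

/-- **Sprung 2012, Prop. 6.14 (first sentence, `η = 1`): `L♯` and `L♭` are not both zero.** For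
`f` the newform of an elliptic curve `E = W` over `ℚ` (`IsNewformOf W f`) with good reduction at the
prime `p`, and ANY `a ∈ ℤ`, `L♯, L♭ ∈ Λ` with `IsSprungPair f p a L♯ L♭`
(`θ_n ≡ −(u_n L♯ + v_n L♭) (mod ω_n)` for all `n`): `L♯ ≠ 0 ∨ L♭ ≠ 0`. Proof (Sprung's, through
Rohrlich): were both zero, `θ_n ≡ 0 (mod ω_n)` for every `n`, so every Birch sum at every wild
character of `p`-power conductor `p^{n+e₀}` would vanish (`IsCongrModOmega.eval₂_eq` +
`eval₂_mazurTateElement_eq_ratTwistedSymbolSum`), i.e. `L(E, χ̄, 1) = 0` for infinitely many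
primitive `χ` — impossible by Rohrlich 1984 (`Rohrlich1984_nonvanishing_twists_holds`). No parity,
supersingularity or `a = a_p(E)` hypothesis is used. [cite: Sprung2012, Prop. 6.14 (p. 1498)]
[cite: RohrlichInventiones1984, Theorem (p. 409)] -/
theorem IsSprungPair.ne_zero_or_ne_zero (hf : IsNewformOf W f)
    (hgood : W.HasGoodReductionAtPrime p) {a : ℤ} {Lsharp Lflat : IwasawaAlgebra p}
    (hSP : IsSprungPair f p a Lsharp Lflat) : Lsharp ≠ 0 ∨ Lflat ≠ 0 := by
  by_contra h
  simp only [not_or, not_ne_iff] at h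
  obtain ⟨h1, h2⟩ := h
  subst h1 h2
  refine false_of_forall_ratTwistedSymbolSum_eq_zero hf hgood fun i χ _ hev hord ↦ ?_
  -- level `p^{i+3} = p^{n + e₀}` with `n = i + 3 − e₀` (`e₀ ∈ {1, 2}`)
  have he : cyclotomicExponent p = 1 ∨ cyclotomicExponent p = 2 := by
    unfold cyclotomicExponent
    split_ifs <;> simp
  have hlev : ∀ (M n : ℕ) (_ : M = n + cyclotomicExponent p)
      (χ : DirichletCharacter ℂ_[p] (p ^ M)), χ.Even → (∃ j : ℕ, orderOf χ = p ^ j) →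
      ratTwistedSymbolSum f χ = 0 := by
    intro M n hM χ hev hord
    subst hM
    have h0 := hSP n
    rw [mul_zero, mul_zero, add_zero] at h0
    exact ratTwistedSymbolSum_eq_zero_of_isCongrModOmega_zero h0 χ hev hord
  rcases he with he | he
  · exact hlev (i + 3) (i + 2) (by rw [he]) χ hev hord
  · exact hlev (i + 3) (i + 1) (by rw [he]) χ hev hord

/-- Chromatic form of Prop. 6.14 (first sentence): **some colour `• ∈ {♯, ♭}` has `L^• ≠ 0`**.
[cite: Sprung2012, Prop. 6.14 (p. 1498)] -/
theorem IsSprungPair.exists_chromaticL_ne_zero (hf : IsNewformOf W f)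
    (hgood : W.HasGoodReductionAtPrime p) {a : ℤ} {Lsharp Lflat : IwasawaAlgebra p}
    (hSP : IsSprungPair f p a Lsharp Lflat) : ∃ c : Chroma, chromaticL c Lsharp Lflat ≠ 0 := by
  rcases hSP.ne_zero_or_ne_zero hf hgood with h | h
  · exact ⟨.sharp, by rwa [chromaticL_sharp]⟩
  · exact ⟨.flat, by rwa [chromaticL_flat]⟩

/-- **If `L♯ = 0` then `L♭ ≠ 0`** (Prop. 6.14, first sentence). [cite: Sprung2012, Prop. 6.14 (p. 1498)] -/
theorem IsSprungPair.flat_ne_zero_of_sharp_eq_zero (hf : IsNewformOf W f)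
    (hgood : W.HasGoodReductionAtPrime p) {a : ℤ} {Lsharp Lflat : IwasawaAlgebra p}
    (hSP : IsSprungPair f p a Lsharp Lflat) (h : Lsharp = 0) : Lflat ≠ 0 :=
  (hSP.ne_zero_or_ne_zero hf hgood).resolve_left (not_ne_iff.mpr h)

/-- **If `L♭ = 0` then `L♯ ≠ 0`** (Prop. 6.14, first sentence). [cite: Sprung2012, Prop. 6.14 (p. 1498)] -/
theorem IsSprungPair.sharp_ne_zero_of_flat_eq_zero (hf : IsNewformOf W f)
    (hgood : W.HasGoodReductionAtPrime p) {a : ℤ} {Lsharp Lflat : IwasawaAlgebra p}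
    (hSP : IsSprungPair f p a Lsharp Lflat) (h : Lflat = 0) : Lsharp ≠ 0 :=
  (hSP.ne_zero_or_ne_zero hf hgood).resolve_right (not_ne_iff.mpr h)

/-- **The pair is not the zero vector** — Sprung's wording "the vector `(L_p^♯, L_p^♭)` can't be
zero". [cite: Sprung2012, Prop. 6.14 (p. 1498)] -/
theorem IsSprungPair.pair_ne_zero (hf : IsNewformOf W f)
    (hgood : W.HasGoodReductionAtPrime p) {a : ℤ} {Lsharp Lflat : IwasawaAlgebra p}
    (hSP : IsSprungPair f p a Lsharp Lflat) : (Lsharp, Lflat) ≠ (0, 0) := by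
  intro h
  rcases hSP.ne_zero_or_ne_zero hf hgood with h' | h'
  · exact h' (congr_arg Prod.fst h)
  · exact h' (congr_arg Prod.snd h)

/-- **No Sprung pair is `(0, 0)`**: `¬ IsSprungPair f p a 0 0` for the newform of an elliptic curve
with good reduction at `p` (so the characterisation `θ_n ≡ 0 (mod ω_n) ∀ n` is never satisfied —
equivalently, NOT every wild twist `L(E, χ, 1)` of `p`-power conductor vanishes).
[cite: Sprung2012, Prop. 6.14 (p. 1498)] [cite: RohrlichInventiones1984, Theorem (p. 409)] -/
theorem not_isSprungPair_zero_zero (hf : IsNewformOf W f)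
    (hgood : W.HasGoodReductionAtPrime p) (a : ℤ) : ¬ IsSprungPair f p a 0 0 := by
  intro h
  rcases h.ne_zero_or_ne_zero hf hgood with h' | h' <;> exact h' rfl

/-- **Every pair produced by Sprung's existence theorem has a non-zero member**: under the named
fact `thm112_exists_isSprungPair` (Sprung 2017 Thm. 1.12, PROVED in the tree as
`thm112_exists_isSprungPair_holds`), at an odd prime `p` of good supersingular reduction there is a
Sprung pair `(L♯, L♭)` for `a_p(E)` with `L♯ ≠ 0 ∨ L♭ ≠ 0` (indeed every such pair has this
property). [cite: Sprung2012, Prop. 6.14 (p. 1498)] [cite: Sprung2017, Thm. 1.12] -/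
theorem exists_isSprungPair_ne_zero_or_ne_zero_of_thm112
    (h112 : thm112_exists_isSprungPair (W := W) (f := f) (p := p)) (hp2 : p ≠ 2)
    (hf : IsNewformOf W f) (hgood : W.HasGoodReductionAtPrime p)
    (hss : (p : ℤ) ∣ W.frobeniusTrace p) :
    ∃ Lsharp Lflat : IwasawaAlgebra p,
      IsSprungPair f p (W.frobeniusTrace p) Lsharp Lflat ∧ (Lsharp ≠ 0 ∨ Lflat ≠ 0) := by
  obtain ⟨Lsharp, Lflat, hSP⟩ := h112 hp2 hf hgood hss
  exact ⟨Lsharp, Lflat, hSP, hSP.ne_zero_or_ne_zero hf hgood⟩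

end NonVanishing

end Literature.NumberTheory.EllipticCurves.Sprung2017

end
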